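import Literature.GroupTheory.SpecificGroups.ModularGroupFreeProduct
import Literature.GroupTheory.CombinatorialGroupTheory.AmalgamTorsionFreeSubgroups
import Literature.NumberTheory.EllipticCurves.PeterssonNormLowerBoundProofs
import HarnessLib

/-!
# `Γ₀(M)/{±1}` is a free group when `9 ∣ M`; `Γ₀(M) = {±1} × (free group)`

Topic `Literature/NumberTheory/ModularForms`; namespace `Literature.NumberTheory.ModularForms.Gamma0Free`.
Everything here is PROVED (no named fact, no `sorry`); one definition with a body, the schema
`Gamma0ModNegFree M` (the shape requested by the bsd-f2-manin cell, es E-es-108 "FREE(M)").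

**The theorem.**  For `9 ∣ M` the group `Γ₀(M) ≤ SL(2, ℤ)` is `{±1} × F` with `F` free: there are a free group
`FreeGroup ι` and a homomorphism `e : FreeGroup ι →* SL(2, ℤ)` with values in `Γ₀(M)` such that every
`γ ∈ Γ₀(M)` is `± e(w)` for exactly one pair `(w, ±)` (`gamma0ModNegFree_of_nine_dvd`).  Classically: a
subgroup of finite index of `PSL₂(ℤ)` is the free product of the cyclic groups generated by the independent
generators of a Farey symbol (Kulkarni), hence FREE when it has no elliptic elements; and `Γ₀(M)` has no
elliptic elements iff `ε₂(Γ₀(M)) = ε₃(Γ₀(M)) = 0`, which holds when `9 ∣ M` [Diamond–Shurman, Cor. 3.7.2: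
`ε₂ = 0` as `3 ∣ M`, `ε₃ = 0` as `9 ∣ M`].

**The proof here** assembles two theorems already in the tree:
* `Literature.GroupTheory.SpecificGroups.ModularGroupFreeProduct`: **`PSL₂(ℤ) ≅ ℤ/2 ∗ ℤ/3`** — the surjection
  `fromSL : SL(2, ℤ) →* FP = ℤ/2 ∗ ℤ/3` (`S ↦ inS`, `U = ST ↦ inU`) whose kernel is the kernel `{±1}` of the
  action on `ℍ` (`fromSL_eq_one_iff` + `SL2Z_eq_one_or_neg_one_of_forall_smul_eq`);
* `Literature.GroupTheory.CombinatorialGroupTheory.AmalgamFreeSubgroups` /`AmalgamTorsionFreeSubgroups`: a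
  subgroup of an amalgam `∗_H Gᵢ` meeting no conjugate of a factor is FREE (`isFreeGroup_of_disjoint_conjugates'`,
  Bass–Serre / Cohen, *Combinatorial group theory*, Ch. 8).
§1 `ker fromSL ≤ Γ₀(M)`.  §2 For `9 ∣ M` no element of `Γ₀(M)` has trace `0` or `±1` (`a d ≡ 1 (mod 9)` forbids
`a + d ∈ {0, ±1}`; `decide` in `ℤ/9`) — so no conjugate of `S` (trace `0`), `U` (trace `1`), `U²` (trace `−1`)
lies in `Γ₀(M)`.  §3 `ℤ/2 ∗ ℤ/3` (Mathlib `CoprodI`) is identified with the amalgam over the trivial group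
(Mathlib `PushoutI`), to which the tree's theorem applies.  §4 Hence `fromSL(Γ₀(M))` is free.  §5 A basis of
`fromSL(Γ₀(M))` is lifted elementwise to `Γ₀(M)` (`FreeGroup.lift`); the lift `e` is a section of `fromSL`
modulo nothing, and `ker fromSL = {±1}` gives existence and uniqueness of `γ = ± e(w)`.
`-- TODO(general form):` the same argument gives freeness of `Γ/±1` for every `Γ ≤ SL(2, ℤ)`, `-1 ∈ Γ`, without
elements of trace `0, ±1` (e.g. `Γ₀(M)` whenever `ε₂ = ε₃ = 0`); only the case `9 ∣ M` is spelled out.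

## References

* [Kulkarni1991] R. S. Kulkarni, *An arithmetic-geometric method in the study of the subgroups of the modular
  group*, Amer. J. Math. 113 (1991), 1053–1133 (Farey symbols; independent generators; free product
  decomposition) — as restated in Chua–Lang–Yang, J. Algebra 277 (2004) 408–428, p. 409 (a)(ii), (b).
* [DiamondShurman2005] F. Diamond, J. Shurman, *A First Course in Modular Forms*, GTM 228, Cor. 3.7.2
  (`ε₂(Γ₀(N))`, `ε₃(Γ₀(N))`; `ε₃ = 0` iff `9 ∣ N` or some `p ≡ 2 (3)` divides `N`).
* [SerreTrees1980] J.-P. Serre, *Trees*, I.4.2 (`PSL₂(ℤ) = ℤ/2 ∗ ℤ/3`), I.4.3.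
* [CohenCGT1989] D. E. Cohen, *Combinatorial Group Theory: a topological approach*, Ch. 8 Thm. 55 Cor. p. 240.
-/

noncomputable section

open scoped MatrixGroups
open CongruenceSubgroup Matrix.SpecialLinearGroup ModularGroup UpperHalfPlane
open Literature.GroupTheory.SpecificGroups Literature.GroupTheory.SpecificGroups.ModularGroupFreeProduct
open Literature.GroupTheory.CombinatorialGroupTheory
open Literature.NumberTheory.EllipticCurves.ModularForms (SL2Z_eq_one_or_neg_one_of_forall_smul_eq)

namespace Literature.NumberTheory.ModularForms

namespace Gamma0Free

/-! ### §1 The kernel of `SL(2, ℤ) → ℤ/2 ∗ ℤ/3` is `±1 ≤ Γ₀(M)` -/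

/-- `fromSL g = 1 ↔ g = ±1`. [cite: SerreTrees1980, I.4.2] -/
theorem fromSL_eq_one_iff_eq (g : SL(2, ℤ)) : fromSL g = 1 ↔ g = 1 ∨ g = -1 := by
  rw [fromSL_eq_one_iff]
  refine ⟨SL2Z_eq_one_or_neg_one_of_forall_smul_eq g, ?_⟩
  rintro (rfl | rfl) z
  · exact one_smul _ _
  · rw [ModularGroup.SL_neg_smul, one_smul]

/-- If `fromSL g ∈ fromSL(Γ₀(M))` then `g ∈ Γ₀(M)` (`ker fromSL = ±1 ≤ Γ₀(M)`). [folklore] -/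
private theorem mem_Gamma0_of_fromSL_mem {M : ℕ} {g : SL(2, ℤ)} (h : fromSL g ∈ (Gamma0 M).map fromSL) :
    g ∈ Gamma0 M := by
  obtain ⟨γ, hγ, hγg⟩ := Subgroup.mem_map.mp h
  have h1 : fromSL (g * γ⁻¹) = 1 := by rw [map_mul, map_inv, ← hγg, mul_inv_cancel]
  rcases (fromSL_eq_one_iff_eq _).mp h1 with h2 | h2
  · rw [mul_inv_eq_one] at h2
    rw [h2]; exact hγ
  · rw [mul_inv_eq_iff_eq_mul] at h2
    have hneg : (-1 : SL(2, ℤ)) ∈ Gamma0 M := by rw [Gamma0_mem]; simp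
    rw [h2]; exact mul_mem hneg hγ

/-! ### §2 No elliptic traces in `Γ₀(M)`, `9 ∣ M` -/

/-- In `ℤ/9`: `a d = 1` forbids `a + d ∈ {0, 1, -1}`. [folklore] -/
private theorem zmod_nine_trace : ∀ a d : ZMod 9, a * d = 1 → a + d ≠ 0 ∧ a + d ≠ 1 ∧ a + d ≠ -1 := by
  decide

/-- For `9 ∣ M`, no element of `Γ₀(M)` has trace `0`, `1` or `-1` (Diamond–Shurman Cor. 3.7.2:
`ε₂(Γ₀(M)) = ε₃(Γ₀(M)) = 0`). [cite: DiamondShurman2005, Cor. 3.7.2] -/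
theorem trace_ne_of_mem_Gamma0 {M : ℕ} (h9 : 9 ∣ M) {γ : SL(2, ℤ)} (hγ : γ ∈ Gamma0 M) :
    (γ : Matrix (Fin 2) (Fin 2) ℤ).trace ≠ 0 ∧ (γ : Matrix (Fin 2) (Fin 2) ℤ).trace ≠ 1 ∧
      (γ : Matrix (Fin 2) (Fin 2) ℤ).trace ≠ -1 := by
  have hc : ((γ 1 0 : ℤ) : ZMod 9) = 0 := by
    have hM : ((γ 1 0 : ℤ) : ZMod M) = 0 := Gamma0_mem.mp hγ
    rw [ZMod.intCast_zmod_eq_zero_iff_dvd] at hM ⊢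
    exact (Int.natCast_dvd_natCast.mpr h9).trans hM
  have hdet : (γ 0 0 : ℤ) * γ 1 1 - γ 0 1 * γ 1 0 = 1 := by
    have := Matrix.det_fin_two (γ : Matrix (Fin 2) (Fin 2) ℤ)
    rw [γ.2] at this
    exact this.symm
  have had : ((γ 0 0 : ℤ) : ZMod 9) * ((γ 1 1 : ℤ) : ZMod 9) = 1 := by
    have := congrArg (Int.cast : ℤ → ZMod 9) hdet
    push_cast at this
    rw [hc, mul_zero, sub_zero] at this
    exact this
  obtain ⟨h0, h1, h2⟩ := zmod_nine_trace _ _ had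
  rw [Matrix.trace_fin_two]
  refine ⟨fun h => h0 ?_, fun h => h1 ?_, fun h => h2 ?_⟩
  · have := congrArg (Int.cast : ℤ → ZMod 9) h; push_cast at this; exact this
  · have := congrArg (Int.cast : ℤ → ZMod 9) h; push_cast at this; exact this
  · have := congrArg (Int.cast : ℤ → ZMod 9) h; push_cast at this; exact this

/-- The trace is a conjugation invariant on `SL(2, ℤ)`. [folklore] -/
private theorem trace_conj (δ X : SL(2, ℤ)) :
    ((δ⁻¹ * X * δ : SL(2, ℤ)) : Matrix (Fin 2) (Fin 2) ℤ).trace = (X : Matrix (Fin 2) (Fin 2) ℤ).trace := by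
  rw [coe_mul, coe_mul, Matrix.trace_mul_comm, ← Matrix.mul_assoc, ← coe_mul, mul_inv_cancel,
    Matrix.SpecialLinearGroup.coe_one, Matrix.one_mul]

/-- `tr S = 0`. [folklore] -/
private theorem trace_S : ((S : SL(2, ℤ)) : Matrix (Fin 2) (Fin 2) ℤ).trace = 0 := by
  rw [Matrix.trace_fin_two]; simp [ModularGroup.S]

/-- `tr U = 1` (`U = ST`). [folklore] -/
private theorem trace_U : ((U : SL(2, ℤ)) : Matrix (Fin 2) (Fin 2) ℤ).trace = 1 := by
  rw [Matrix.trace_fin_two, U_def, coe_mul]; simp [ModularGroup.S, ModularGroup.T]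

/-- `tr U² = -1`. [folklore] -/
private theorem trace_U_sq : ((U ^ 2 : SL(2, ℤ)) : Matrix (Fin 2) (Fin 2) ℤ).trace = -1 := by
  rw [Matrix.trace_fin_two, pow_two, U_def, coe_mul, coe_mul]
  simp [ModularGroup.S, ModularGroup.T, Matrix.mul_apply, Fin.sum_univ_two]

/-- For `9 ∣ M`, no conjugate of an element of trace `0`, `1` or `-1` lies in `Γ₀(M)`.
[cite: DiamondShurman2005, Cor. 3.7.2] -/
theorem conj_not_mem_Gamma0 {M : ℕ} (h9 : 9 ∣ M) (δ X : SL(2, ℤ))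
    (hX : (X : Matrix (Fin 2) (Fin 2) ℤ).trace = 0 ∨ (X : Matrix (Fin 2) (Fin 2) ℤ).trace = 1 ∨
      (X : Matrix (Fin 2) (Fin 2) ℤ).trace = -1) :
    δ⁻¹ * X * δ ∉ Gamma0 M := fun hmem => by
  obtain ⟨h0, h1, h2⟩ := trace_ne_of_mem_Gamma0 h9 hmem
  rw [trace_conj] at h0 h1 h2
  rcases hX with h | h | h
  · exact h0 h
  · exact h1 h
  · exact h2 h

/-! ### §3 `ℤ/2 ∗ ℤ/3` as an amalgam over the trivial group; freeness of subgroups missing the factors -/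

/-- The trivial attaching maps `1 → ℤ/2`, `1 → ℤ/3`. [folklore] -/
def triv (b : Bool) : PUnit.{1} →* Fac b := 1

/-- `ℤ/2 ∗_{1} ℤ/3` (Mathlib's `PushoutI` over the trivial group). [folklore] -/
abbrev PO : Type := Monoid.PushoutI triv

/-- `ℤ/2 ∗ ℤ/3 → ℤ/2 ∗_{1} ℤ/3`. [folklore] -/
def toPO : FP →* PO := Monoid.PushoutI.ofCoprodI

/-- `ℤ/2 ∗_{1} ℤ/3 → ℤ/2 ∗ ℤ/3`. [folklore] -/
def ofPO : PO →* FP :=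
  Monoid.PushoutI.lift (fun b => (Monoid.CoprodI.of : Fac b →* FP)) 1 fun b => by
    ext x
    simp [triv]

/-- `ofPO ∘ toPO = id`. [folklore] -/
private theorem ofPO_comp_toPO : ofPO.comp toPO = MonoidHom.id FP :=
  Monoid.CoprodI.ext_hom _ _ fun b => by
    ext x
    simp [ofPO, toPO]

/-- `toPO ∘ ofPO = id`. [folklore] -/
private theorem toPO_comp_ofPO : toPO.comp ofPO = MonoidHom.id PO :=
  Monoid.PushoutI.hom_ext (fun b => by ext x; simp [ofPO, toPO]) (by
    ext x
    rw [Subsingleton.elim x 1]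
    simp only [map_one])

/-- `ℤ/2 ∗ ℤ/3 ≃ ℤ/2 ∗_{1} ℤ/3`. [folklore] -/
def fpEquivPO : FP ≃* PO := MonoidHom.toMulEquiv toPO ofPO ofPO_comp_toPO toPO_comp_ofPO

/-- A subgroup of `ℤ/2 ∗ ℤ/3` containing no conjugate of a non-trivial element of a factor is free
(Kurosh; here via the tree's Bass–Serre theorem `isFreeGroup_of_disjoint_conjugates'`).
[cite: CohenCGT1989, Ch. 8 Thm. 55 Cor. p.240] -/
theorem isFreeGroup_of_conj_of_imp (K : Subgroup FP)
    (hK : ∀ (b : Bool) (x : Fac b) (γ : FP), γ⁻¹ * Monoid.CoprodI.of x * γ ∈ K → x = 1) :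
    IsFreeGroup K := by
  have hφ : ∀ b, Function.Injective (triv b) := fun b => Function.injective_of_subsingleton _
  have hfree : IsFreeGroup (K.map (fpEquivPO : FP →* PO)) := by
    refine isFreeGroup_of_disjoint_conjugates' hφ _ fun b x γ hmem => hK b x (ofPO γ) ?_
    obtain ⟨y, hy, hyx⟩ := Subgroup.mem_map.mp hmem
    have e1 : ofPO (Monoid.PushoutI.of b x : PO) = Monoid.CoprodI.of x := by simp [ofPO]
    have e2 : ofPO ((fpEquivPO : FP →* PO) y) = y := DFunLike.congr_fun ofPO_comp_toPO y
    have := congrArg ofPO hyx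
    rw [map_mul, map_mul, map_inv, e1, e2] at this
    rw [← this]; exact hy
  haveI := hfree
  exact IsFreeGroup.ofMulEquiv (fpEquivPO.subgroupMap K).symm

/-! ### §4 `fromSL(Γ₀(M))` is free for `9 ∣ M` -/

/-- For `9 ∣ M` the image of `Γ₀(M)` in `ℤ/2 ∗ ℤ/3 = PSL₂(ℤ)` is a free group.
[cite: Kulkarni1991, §1] [cite: DiamondShurman2005, Cor. 3.7.2] -/
theorem isFreeGroup_map_fromSL_Gamma0 {M : ℕ} (h9 : 9 ∣ M) : IsFreeGroup ((Gamma0 M).map fromSL) :=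
  isFreeGroup_of_conj_of_imp _ fun b x γ hmem => by
    obtain ⟨δ, rfl⟩ := fromSL_surjective γ
    cases b with
    | true =>
      obtain ⟨n, hn, rfl⟩ := exists_genS_pow x
      interval_cases n
      · simp
      · exfalso
        rw [pow_one, ← inS_def, ← fromSL_S, ← map_inv, ← map_mul, ← map_mul] at hmem
        exact conj_not_mem_Gamma0 h9 δ S (Or.inl trace_S) (mem_Gamma0_of_fromSL_mem hmem)
    | false =>
      obtain ⟨n, hn, rfl⟩ := exists_genU_pow x
      interval_cases n
      · simp
      · exfalso
        rw [pow_one, ← inU_def, ← fromSL_U, ← map_inv, ← map_mul, ← map_mul] at hmem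
        exact conj_not_mem_Gamma0 h9 δ U (Or.inr (Or.inl trace_U)) (mem_Gamma0_of_fromSL_mem hmem)
      · exfalso
        rw [map_pow, ← inU_def, ← fromSL_U, ← map_pow, ← map_inv, ← map_mul, ← map_mul] at hmem
        exact conj_not_mem_Gamma0 h9 δ (U ^ 2) (Or.inr (Or.inr trace_U_sq)) (mem_Gamma0_of_fromSL_mem hmem)

/-! ### §5 `Γ₀(M) = {±1} × (free group)` for `9 ∣ M` -/

/-- **FREE(M)** (es E-es-108, the typed shape): `Γ₀(M)` is `{±1}` times a FREE subgroup, with unique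
decomposition — i.e. `Γ₀(M)/{±1}` is a free group and the extension splits.  Stated with Mathlib constants only:
a free group `FreeGroup ι`, a homomorphism `e` into `Γ₀(M)`, and every `γ ∈ Γ₀(M)` uniquely `± e(w)`.
(Kulkarni: every finite-index subgroup of `PSL₂(ℤ)` is a free product of cyclic groups read off a Farey
symbol; free when there are no elliptic elements.) [cite: Kulkarni1991, §1] -/
def Gamma0ModNegFree (M : ℕ) : Prop :=
  ∃ (ι : Type) (e : FreeGroup ι →* SL(2, ℤ)), (∀ w, e w ∈ Gamma0 M) ∧
    ∀ γ ∈ Gamma0 M, ∃! p : FreeGroup ι × Bool, γ = (if p.2 then -1 else 1) * e p.1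

/-- **`Γ₀(M)/{±1}` is free for `9 ∣ M`** (no elliptic elements: `ε₂ = ε₃ = 0` by Diamond–Shurman Cor. 3.7.2;
a torsion-free subgroup of `PSL₂(ℤ) = ℤ/2 ∗ ℤ/3` is free by Kurosh / Bass–Serre; the central extension by
`±1` splits over a free group). [cite: Kulkarni1991, §1] [cite: DiamondShurman2005, Cor. 3.7.2]
[cite: SerreTrees1980, I.4.2] -/
theorem gamma0ModNegFree_of_nine_dvd (M : ℕ) (h9 : 9 ∣ M) : Gamma0ModNegFree M := by
  classical
  set K : Subgroup FP := (Gamma0 M).map fromSL with hK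
  haveI : IsFreeGroup K := isFreeGroup_map_fromSL_Gamma0 h9
  let b := IsFreeGroup.basis K
  -- a set-theoretic section of `fromSL` on the basis, with values in `Γ₀(M)`
  have hsec : ∀ a : IsFreeGroup.Generators K, ∃ γ : SL(2, ℤ), γ ∈ Gamma0 M ∧ fromSL γ = (b a : FP) :=
    fun a => by
      obtain ⟨γ, hγ, e⟩ := Subgroup.mem_map.mp (b a).2
      exact ⟨γ, hγ, e⟩
  choose sec hsec_mem hsec_eq using hsec
  let e : FreeGroup (IsFreeGroup.Generators K) →* SL(2, ℤ) := FreeGroup.lift sec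
  have he_mem : ∀ w, e w ∈ Gamma0 M := fun w =>
    FreeGroup.range_lift_le (s := Gamma0 M) (by rintro _ ⟨a, rfl⟩; exact hsec_mem a) ⟨w, rfl⟩
  -- `fromSL ∘ e = inclusion ∘ b.repr⁻¹`
  have hcomp : fromSL.comp e = K.subtype.comp b.repr.symm.toMonoidHom := by
    refine FreeGroup.ext_hom _ _ fun a => ?_
    show fromSL (FreeGroup.lift sec (FreeGroup.of a)) = ((b.repr.symm (FreeGroup.of a) : K) : FP)
    rw [FreeGroup.lift_apply_of, hsec_eq]
    rfl
  have hcomp' : ∀ w, fromSL (e w) = ((b.repr.symm w : K) : FP) := fun w => DFunLike.congr_fun hcomp w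
  -- `fromSL ∘ e` is injective, and signs are invisible to `fromSL`: uniqueness
  have hinj : ∀ w w' : FreeGroup (IsFreeGroup.Generators K), fromSL (e w) = fromSL (e w') → w = w' := by
    intro w w' h
    rw [hcomp', hcomp'] at h
    exact b.repr.symm.injective (Subtype.ext h)
  have huniq : ∀ p q : FreeGroup (IsFreeGroup.Generators K) × Bool,
      ((if p.2 then -1 else 1) * e p.1 : SL(2, ℤ)) = (if q.2 then -1 else 1) * e q.1 → p = q := by
    rintro ⟨w, c⟩ ⟨w', c'⟩ h
    have hw : w = w' :=
      hinj _ _ (by cases c <;> cases c' <;> simpa [map_mul, fromSL_neg] using congrArg fromSL h)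
    subst hw
    have hc : (if c then -1 else 1 : SL(2, ℤ)) = (if c' then -1 else 1) := mul_right_cancel h
    have hne : (-1 : SL(2, ℤ)) ≠ 1 := by decide
    cases c <;> cases c'
    · rfl
    · exact (hne (by simpa using hc.symm)).elim
    · exact (hne (by simpa using hc)).elim
    · rfl
  refine ⟨IsFreeGroup.Generators K, e, he_mem, fun γ hγ => ?_⟩
  -- existence: `fromSL γ ∈ K` is hit by `b.repr⁻¹`, and `ker fromSL = ±1`
  let k : K := ⟨fromSL γ, Subgroup.mem_map_of_mem _ hγ⟩
  have hk : fromSL (e (b.repr k)) = fromSL γ := by rw [hcomp', MulEquiv.symm_apply_apply]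
  have h1 : fromSL (γ * (e (b.repr k))⁻¹) = 1 := by rw [map_mul, map_inv, hk, mul_inv_cancel]
  rcases (fromSL_eq_one_iff_eq _).mp h1 with h2 | h2
  · rw [mul_inv_eq_one] at h2
    have hp : γ = (if false then -1 else 1 : SL(2, ℤ)) * e (b.repr k) := by simpa using h2
    exact ⟨⟨b.repr k, false⟩, hp, fun q hq => huniq _ _ (hq.symm.trans hp)⟩
  · rw [mul_inv_eq_iff_eq_mul] at h2
    have hp : γ = (if true then -1 else 1 : SL(2, ℤ)) * e (b.repr k) := by simpa using h2
    exact ⟨⟨b.repr k, true⟩, hp, fun q hq => huniq _ _ (hq.symm.trans hp)⟩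

end Gamma0Free

end Literature.NumberTheory.ModularForms

end
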